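import Summits.RiemannHypothesis.RiemannHypothesis.Theorems.GroundBartaPolarPerronFrobeniusEvenRealGroundState
import HarnessLib

/-!
# RiemannHypothesis / GroundBarta — crux `PolarPerronFrobenius` (stmt-RiemannHypothesis-18390):
# one-signed ground states may be taken EVEN, and the parity-pure normal form of the crux

Helper file (`--supports`), RH-free, continuation of
`Theorems/GroundBartaPolarPerronFrobeniusEvenRealGroundState.lean`.

* `exists_even_real_nonneg_of_oneSigned` — **a one-signed ground state may be taken even, real-valued
  and `≥ 0` everywhere.**  If `u` is a ground state of the full windowed Weil form at `a`
  (`IsWeilGroundState a u`) that is real and `≥ 0` a.e. on `(-a, a)`, modify it on a null set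
  (`IsWeilGroundState.congr_ae`; `u = 0` a.e. off `[-a, a]`, endpoints are null) to the real
  non-negative function `u' = 𝟙_{(-a,a)} max(Re u, 0)`; its even part `½(u' + u'(-·))` is `≥ ½ u'`
  pointwise, hence has `L²`-mass `≥ ¼`, and the normalised even part of a ground state is a ground state
  (`GroundStatesConvergeToXi.isWeilGroundState_evenPart`).
* `polarPerronFrobenius_iff_even` — hence the **parity-pure normal form**:
  `PolarPerronFrobenius ↔ ∀ A, ∃ a ≥ A, (ε_ev(a) ≤ ε_od(a) → ∃ u, IsWeilGroundState a u ∧ u even ∧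
  Im u = 0 ∧ 0 ≤ Re u (everywhere))`.
  Read against `exists_even_real_isWeilGroundState` (an even real-valued ground state EXISTS at every
  even-winning window, RH-free) and `polarPerronFrobenius_of_persistence` of the companion file: the
  whole RH-bearing content of the crux is WHICH even real ground state — the existence of a one-signed
  one among them, cofinally in the window.

References: E. Bombieri, Rend. Lincei (9) 11 (2000) §4; A. Connes, C. Consani, H. Moscovici,
arXiv:2511.22755 (2025) §8.
-/

set_option linter.dupNamespace false

noncomputable section

open MeasureTheory Complex Filter Set
open scoped Real Topology

namespace Summit.RiemannHypothesis.RiemannHypothesis.Theorems.PolarPerronFrobenius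

open Literature.NumberTheory.LFunctions
open Summit.RiemannHypothesis.RiemannHypothesis.Theses.GroundBarta

/-- **A one-signed ground state may be taken even, real-valued and non-negative everywhere.**  If a
ground state `u` at the window `a` is real and `≥ 0` a.e. on `(-a, a)`, then there is a ground state `v`
at `a` with `v(-t) = v(t)`, `Im v = 0` and `Re v ≥ 0` for every `t` (the normalised even part of the
null-set modification `𝟙_{(-a,a)} max(Re u, 0)` of `u`). [folklore] -/
theorem exists_even_real_nonneg_of_oneSigned {a : ℝ} {u : ℝ → ℂ} (hu : IsWeilGroundState a u)
    (hsign : ∀ᵐ t : ℝ, t ∈ Ioo (-a) a → (u t).im = 0 ∧ 0 ≤ (u t).re) :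
    ∃ v : ℝ → ℂ, IsWeilGroundState a v ∧ (∀ t, v (-t) = v t) ∧ (∀ t, (v t).im = 0) ∧
      ∀ t, 0 ≤ (v t).re := by
  -- the everywhere-real, everywhere-`≥ 0` representative
  set u' : ℝ → ℂ := (Ioo (-a) a).indicator fun t ↦ ((max (u t).re 0 : ℝ) : ℂ) with hu'def
  have hu're : ∀ t, (u' t).im = 0 := fun t ↦ by
    rw [hu'def]
    by_cases ht : t ∈ Ioo (-a) a
    · rw [indicator_of_mem ht, Complex.ofReal_im]
    · rw [indicator_of_notMem ht, Complex.zero_im]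
  have hu'nn : ∀ t, 0 ≤ (u' t).re := fun t ↦ by
    rw [hu'def]
    by_cases ht : t ∈ Ioo (-a) a
    · rw [indicator_of_mem ht, Complex.ofReal_re]
      exact le_max_right _ _
    · rw [indicator_of_notMem ht, Complex.zero_re]
  have hae : u =ᵐ[volume] u' := by
    filter_upwards [hsign, hu.ae_eq_zero_of_notMem, Measure.ae_ne volume a,
      Measure.ae_ne volume (-a)] with t h1 h2 h3 h4
    rw [hu'def]
    by_cases ht : t ∈ Ioo (-a) a
    · obtain ⟨him, hre⟩ := h1 ht
      rw [indicator_of_mem ht, max_eq_left hre]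
      exact Complex.ext (by simp) (by simp [him])
    · rw [indicator_of_notMem ht]
      refine h2 fun htI ↦ ht ⟨lt_of_le_of_ne htI.1 (Ne.symm h4), lt_of_le_of_ne htI.2 h3⟩
  have hu' : IsWeilGroundState a u' := hu.congr_ae hae
  -- its even part has `L²`-mass `≥ 1/4`
  set N : ℝ := ∫ t, ‖(u' t + u' (-t)) / 2‖ ^ 2 with hNdef
  have hpt : ∀ t, ‖u' t‖ ^ 2 / 4 ≤ ‖(u' t + u' (-t)) / 2‖ ^ 2 := by
    intro t
    have e1 : u' t = (((u' t).re : ℝ) : ℂ) := Complex.ext (by simp) (by simp [hu're t])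
    have e2 : u' (-t) = (((u' (-t)).re : ℝ) : ℂ) := Complex.ext (by simp) (by simp [hu're (-t)])
    have h1 := hu'nn t
    have h2 := hu'nn (-t)
    rw [e1, e2, ← Complex.ofReal_add, ← Complex.ofReal_ofNat, ← Complex.ofReal_div,
      Complex.norm_real, Complex.norm_real, Real.norm_of_nonneg h1,
      Real.norm_of_nonneg (by positivity)]
    nlinarith
  have hN : 0 < N := by
    have hi1 : Integrable fun t ↦ ‖u' t‖ ^ 2 / 4 :=
      (GroundStatesConvergeToXi.integrable_norm_sq_of_memLp hu'.memLp).div_const 4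
    have hi2 : Integrable fun t ↦ ‖(u' t + u' (-t)) / 2‖ ^ 2 :=
      GroundStatesConvergeToXi.integrable_norm_sq_of_memLp
        (GroundStatesConvergeToXi.memLp_evenPart hu'.memLp)
    have hmono := integral_mono hi1 hi2 hpt
    have h1 : ∫ t, ‖u' t‖ ^ 2 / 4 = 1 / 4 := by
      rw [integral_div, hu'.integral_norm_sq]
    rw [h1] at hmono
    rw [hNdef]
    linarith
  refine ⟨_, GroundStatesConvergeToXi.isWeilGroundState_evenPart hu' hN, fun t ↦ ?_, fun t ↦ ?_,
    fun t ↦ ?_⟩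
  · simp only [neg_neg, add_comm (u' (-t)) (u' t)]
  · simp [Complex.mul_im, hu're t, hu're (-t)]
  · simp only [Complex.mul_re, Complex.ofReal_re, Complex.ofReal_im, zero_mul, sub_zero]
    refine mul_nonneg (inv_nonneg.2 (Real.sqrt_nonneg _)) ?_
    have : ((u' t + u' (-t)) / 2).re = ((u' t).re + (u' (-t)).re) / 2 := by
      simp [Complex.add_re]
    rw [this]
    linarith [hu'nn t, hu'nn (-t)]

/-- **Parity-pure normal form of the crux.**  `PolarPerronFrobenius` holds if and only if beyond every
height there is a window `a` at which `ε_ev(a) ≤ ε_od(a)` implies the existence of an EVEN, REAL-VALUED,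
everywhere `≥ 0` ground state of the full windowed Weil form.  (With `exists_even_real_isWeilGroundState`:
even real-valued ground states exist at every even-winning window RH-free, so the content of the crux is
that ONE OF THEM is one-signed, cofinally in the window.) [folklore] -/
theorem polarPerronFrobenius_iff_even :
    PolarPerronFrobenius ↔
      ∀ A : ℝ, ∃ a : ℝ, A ≤ a ∧ (weilEvenGroundEnergy a ≤ weilOddGroundEnergy a →
        ∃ u : ℝ → ℂ, IsWeilGroundState a u ∧ (∀ t, u (-t) = u t) ∧ (∀ t, (u t).im = 0) ∧
          ∀ t, 0 ≤ (u t).re) := by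
  rw [polarPerronFrobenius_iff_groundEnergy]
  refine forall_congr' fun A ↦ exists_congr fun a ↦ and_congr_right fun _ ↦
    imp_congr_right fun _ ↦ ⟨?_, ?_⟩
  · rintro ⟨u, hu, hsign⟩
    exact exists_even_real_nonneg_of_oneSigned hu hsign
  · rintro ⟨u, hu, -, hre, hnn⟩
    exact ⟨u, hu, Eventually.of_forall fun t _ ↦ ⟨hre t, hnn t⟩⟩

/-- **The crux from cofinal even non-negative ground states** (convenience form of `←`). [folklore] -/
theorem polarPerronFrobenius_of_cofinal_even_nonneg
    (h : ∀ A : ℝ, ∃ a : ℝ, A ≤ a ∧ ∃ u : ℝ → ℂ, IsWeilGroundState a u ∧ (∀ t, u (-t) = u t) ∧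
      (∀ t, (u t).im = 0) ∧ ∀ t, 0 ≤ (u t).re) :
    PolarPerronFrobenius :=
  polarPerronFrobenius_iff_even.2 fun A ↦ (h A).imp fun _ ha ↦ ⟨ha.1, fun _ ↦ ha.2⟩

/-- **What a refutation must exclude**: if the crux fails then, beyond some height, at every window NO
even real-valued ground state is `≥ 0` everywhere — although even real-valued ground states exist there
(`exists_even_real_isWeilGroundState`, as `ε_ev ≤ ε_od` eventually by
`eventually_le_of_not_polarPerronFrobenius`). [folklore] -/
theorem eventually_forall_even_not_nonneg_of_not_polarPerronFrobenius (h : ¬ PolarPerronFrobenius) :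
    ∀ᶠ a in atTop, (∃ u : ℝ → ℂ, IsWeilGroundState a u ∧ (∀ t, u (-t) = u t) ∧ ∀ t, (u t).im = 0) ∧
      ∀ u : ℝ → ℂ, IsWeilGroundState a u → (∀ t, u (-t) = u t) → (∀ t, (u t).im = 0) →
        ¬ ∀ t, 0 ≤ (u t).re := by
  have hle := eventually_le_of_not_polarPerronFrobenius h
  have hno : ∀ᶠ a in atTop, ∀ u : ℝ → ℂ, IsWeilGroundState a u → (∀ t, u (-t) = u t) →
      (∀ t, (u t).im = 0) → ¬ ∀ t, 0 ≤ (u t).re := by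
    by_contra hne
    refine h (polarPerronFrobenius_of_cofinal_even_nonneg fun A ↦ ?_)
    obtain ⟨a, hA, ha⟩ := frequently_atTop.1 (not_eventually.1 hne) A
    refine ⟨a, hA, ?_⟩
    by_contra hcon
    exact ha fun u hu hev hre hnn ↦ hcon ⟨u, hu, hev, hre, hnn⟩
  filter_upwards [hle, hno, eventually_gt_atTop 0] with a h1 h2 h3
  exact ⟨exists_even_real_isWeilGroundState h3 h1, h2⟩

end Summit.RiemannHypothesis.RiemannHypothesis.Theorems.PolarPerronFrobenius

end
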